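import Summits.ResolutionOfSingularities.ResolutionOfSingularities.Theorems.FrobeniusLadderFRationalResolutionPushoutDegreeGroupOrder
import Summits.ResolutionOfSingularities.ResolutionOfSingularities.Theorems.FrobeniusLadderFRationalResolutionRechartDegree
import Summits.ResolutionOfSingularities.ResolutionOfSingularities.Theorems.FrobeniusLadderFRationalResolutionFixedChartOfWildDegree
import Summits.ResolutionOfSingularities.ResolutionOfSingularities.Theorems.FrobeniusLadderFRationalResolutionRootAdjoinRegularOfTameDegree
import Summits.ResolutionOfSingularities.ResolutionOfSingularities.Theorems.FrobeniusLadderFRationalResolutionRootAdjoinRechart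
import Summits.ResolutionOfSingularities.ResolutionOfSingularities.Theorems.FrobeniusLadderFRationalResolutionSubchartOfSummand
import Summits.ResolutionOfSingularities.ResolutionOfSingularities.Theorems.FrobeniusLadderFRationalResolutionRegradeChart
import Summits.ResolutionOfSingularities.ResolutionOfSingularities.Theorems.FrobeniusLadderFRationalResolutionStabilizerSubgroup
import Mathlib.GroupTheory.Coset.Card
import Mathlib.Algebra.CharP.Basic
import HarnessLib

/-!
# Crux `FrobeniusLadder.FRationalResolution` (stmt-ResolutionOfSingularities-15317), line `redirect`,
# stub `stub_diagonalizableQuotientResolution` — item (F2c): the RE-CHARTING STEP — a non-fixed point of a quotient chart is the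
# image of a point of another chart of the same shape whose unit-degree subgroup is STRICTLY SMALLER

The step of the multi-root recipe (MEMO-15317-leafhand2-g22), assembled from the bricks: degree choice `b ∈ B ∖ ℓ·B` of order
`n = ℓ^{e+1}` (`…RechartDegree`), exponent `d = ℓ^f` with `ℓ^f ∥ |A|`, prescribed character `s : A →+ ℤ/(nd)`, `s b = d`
(`…ZModCharacterPrescribed`), pushout degree group `A ↪ A' ∋ a`, `d • a = ι b`, complement `C` of `⟨a⟩` (`…PushoutDegreeGroupOrder`),
regrading (`…RegradeChart`), root adjunction `w^d = u` with its regularity (`ℓ = char k`: `…FixedChartOfWildDegree`; otherwise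
`d ∈ k^×`: `…RootAdjoinRegularOfTameDegree`) and exact unit-degree subgroup (`…RootAdjoinRechart`), split-off along `C × ℤ/d`
(`…SubchartOfSummand`); finally the new unit-degree subgroup receives a non-injective surjection from `B` (`β ↦ (c_β, −s β)`, `b ↦ 0`).

* ★★★ `exists_rechart_card_lt` — chart `(A, S, 𝒮, φ)` of the stub's shape, point `v`, prime `𝔔` over `v` with unit-degree subgroup
  `B ≠ 0` ⇒ a chart of the same shape, a point `v'` with `φ' v' = φ v`, a prime `𝔔'` over `v'` and its unit-degree subgroup `B'`
  with `|B'| < |B|`.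

Honest label: helper toward ONE leaf stub; no stub, crux or summit closed. No definitions, no named facts, no sorry.
[folklore; cite: SGA3, Exp. VIII §4–5] [cite: Matsumura1987, Thm. 14.2; §25; §30, Cor. to Thm. 30.5] [cite: StacksProject, Tag 07NG]
-/

noncomputable section

-- single-problem summit: the doubled namespace component is forced
set_option linter.dupNamespace false

open CategoryTheory AlgebraicGeometry
open Literature.AlgebraicGeometry.Resolution

namespace Summit.ResolutionOfSingularities.ResolutionOfSingularities.Theorems.FRationalResolution.RechartStep

/-- ★★★ **The re-charting step.** See the module docstring. [folklore; cite: SGA3, Exp. VIII §4–5]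
[cite: Matsumura1987, Thm. 14.2; §25; §30, Cor. to Thm. 30.5] [cite: StacksProject, Tag 07NG] -/
theorem exists_rechart_card_lt (k : Type) [Field k] (X : Scheme.{0}) (g : X ⟶ Spec (.of k))
    (A : Type) [AddCommGroup A] [Finite A] [DecidableEq A] (S : Type) [CommRing S] [Algebra k S]
    (𝒮 : A → Submodule k S) [GradedAlgebra 𝒮] [Algebra.FiniteType k S] [IsRegularRing S]
    (φ : Spec (.of (𝒮 0)) ⟶ X) [Etale φ]
    (hφg : φ ≫ g = Spec.map (CommRingCat.ofHom (algebraMap k (𝒮 0))))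
    (v : Spec (.of (𝒮 0))) (𝔔 : Ideal S) [𝔔.IsPrime] (h𝔔v : 𝔔.comap (algebraMap (𝒮 0) S) = v.asIdeal)
    (B : AddSubgroup A) (hB : ∀ i : A, i ∈ B ↔ ∃ s ∈ 𝒮 i, s ∉ 𝔔) (hB0 : B ≠ ⊥) :
    ∃ (A' : Type) (_ : AddCommGroup A') (_ : Finite A') (_ : DecidableEq A')
      (S' : Type) (_ : CommRing S') (_ : Algebra k S') (𝒮' : A' → Submodule k S') (_ : GradedAlgebra 𝒮'),
      Algebra.FiniteType k S' ∧ IsRegularRing S' ∧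
      ∃ (φ' : Spec (.of (𝒮' 0)) ⟶ X), Etale φ' ∧
        φ' ≫ g = Spec.map (CommRingCat.ofHom (algebraMap k (𝒮' 0))) ∧
        ∃ (v' : Spec (.of (𝒮' 0))) (𝔔' : Ideal S') (_ : 𝔔'.IsPrime),
          𝔔'.comap (algebraMap (𝒮' 0) S') = v'.asIdeal ∧
          ∃ B' : AddSubgroup A', (∀ i : A', i ∈ B' ↔ ∃ s ∈ 𝒮' i, s ∉ 𝔔') ∧ Nat.card B' < Nat.card B ∧ φ' v' = φ v := by
  classical
  -- (1) the degree `b ∈ B ∖ ℓ·B` of order `ℓ^(e+1)` and a homogeneous unit `u` of that degree at the point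
  obtain ⟨ℓ, e, hℓ, hℓB, b, hbB, hbord, hbℓ⟩ := RechartDegree.exists_primePow_order_not_mem_nsmul B hB0
  haveI : Fact ℓ.Prime := ⟨hℓ⟩
  obtain ⟨u, hu, huQ⟩ := (hB b).1 hbB
  have hb0 : b ≠ 0 := fun h => by
    rw [h, addOrderOf_zero] at hbord
    exact (Nat.one_lt_pow (Nat.succ_ne_zero e) hℓ.one_lt).ne hbord
  -- (2) the exponent `d = ℓ^(f+1)`, `|A| = ℓ^(f+1) q'`, `ℓ ∤ q'`
  have hcardA : Nat.card A ≠ 0 := Nat.card_pos.ne'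
  obtain ⟨f, q', hq', hAq⟩ := Nat.exists_eq_pow_mul_and_not_dvd hcardA ℓ hℓ.one_lt.ne'
  have hℓA : ℓ ∣ Nat.card A := hℓB.trans (AddSubgroup.card_addSubgroup_dvd_card B)
  obtain ⟨f', rfl⟩ : ∃ f', f = f' + 1 :=
    Nat.exists_eq_add_one.2 (Nat.pos_of_ne_zero fun hf => hq' (by rw [hf, pow_zero, one_mul] at hAq; rwa [← hAq]))
  have hd1 : 1 < ℓ ^ (f' + 1) := Nat.one_lt_pow (Nat.succ_ne_zero _) hℓ.one_lt
  haveI : NeZero (ℓ ^ (f' + 1)) := ⟨by omega⟩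
  haveI : Fact (1 < ℓ ^ (f' + 1)) := ⟨hd1⟩
  -- (3) the prescribed character
  have H : ∀ c : A, (ℓ ^ (e + 1) * ℓ ^ (f' + 1)) • c ≠ ℓ ^ e • b := by
    refine ZModCharacterPrescribed.nsmul_ne_of_nsmul_eq_zero ℓ e (ℓ ^ (e + 1) * ℓ ^ (f' + 1)) q' hℓ hq' (fun c => ?_)
      b hbord
    rw [smul_smul, show q' * (ℓ ^ (e + 1) * ℓ ^ (f' + 1)) = ℓ ^ (e + 1) * (ℓ ^ (f' + 1) * q') by ring, ← hAq,
      ← smul_smul, card_nsmul_eq_zero', smul_zero]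
  obtain ⟨s, hs⟩ : ∃ s : A →+ ZMod (addOrderOf b * ℓ ^ (f' + 1)), s b = ((ℓ ^ (f' + 1) : ℕ) : ZMod _) := by
    rw [hbord]
    exact ZModCharacterPrescribed.exists_addMonoidHom_zmod_apply_eq ℓ e (ℓ ^ (f' + 1)) hℓ b hbord H
  -- (4) the pushout degree group
  obtain ⟨A', iA', fA', ι, a, C, hι, hda, hsupC, hinfC, hdec, hord⟩ :=
    PushoutDegreeGroupOrder.exists_pushout_order b (ℓ ^ (f' + 1)) s hs
  letI := iA'
  haveI := fA'
  choose cf hcfC hcf using hdec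
  -- (5) regrade
  obtain ⟨𝒮', inst𝒮', hle, -, φ', hφ'et, hφ'g, v', h𝔔v', hunits', hφ'v⟩ :=
    RegradeChart.exists_regraded_chart k X g A S 𝒮 φ hφg v 𝔔 h𝔔v B hB A' ι hι
  letI := inst𝒮'
  haveI := hφ'et
  have hA' : AddMonoid.IsTorsion A' := fun x => isOfFinAddOrder_of_finite x
  have hu' : u ∈ 𝒮' (ι b) := hle b hu
  have hbι : ι b ∈ B.map ι := AddSubgroup.mem_map.2 ⟨b, hbB, rfl⟩
  -- (6) regularity of the root-adjunction ring at the primes over the point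
  have hreg : ∀ (𝔓 : Ideal (AdjoinRoot (Polynomial.X ^ (ℓ ^ (f' + 1)) - Polynomial.C u : Polynomial S))) [𝔓.IsPrime],
      𝔓.comap (algebraMap (𝒮' 0) (AdjoinRoot (Polynomial.X ^ (ℓ ^ (f' + 1)) - Polynomial.C u : Polynomial S))) =
        v'.asIdeal → IsRegularLocalRing (Localization.AtPrime 𝔓) := by
    intro 𝔓 _ h𝔓
    have h𝔓' := h𝔓.trans h𝔔v'.symm
    by_cases hchar : (ℓ : k) = 0
    · haveI : CharP k ℓ := (CharP.charP_iff_prime_eq_zero hℓ).2 hchar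
      refine FixedChartOfWildDegree.isRegularLocalRing_localization_adjoinRoot_of_not_mem_nsmul ℓ 𝒮' hA' 𝔔 (B.map ι)
        (fun x hx s' hs' => by_contra fun h => hx ((hunits' x).1 ⟨s', hs', h⟩)) hbι (fun c hc h => ?_) hu' huQ _ 𝔓 h𝔓'
      obtain ⟨c₀, hc₀, rfl⟩ := AddSubgroup.mem_map.1 hc
      rw [← map_nsmul] at h
      exact hbℓ c₀ hc₀ (hι h)
    · refine RootAdjoinRegularOfTameDegree.isRegularLocalRing_localization_adjoinRoot_of_isUnit_natCast 𝒮' hA' 𝔔 hu' huQ _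
        ?_ 𝔓 h𝔓'
      rw [Nat.cast_pow]
      exact (isUnit_iff_ne_zero.2 hchar).pow _
  -- (7) the root adjunction
  obtain ⟨L, iL, aL, ℒ, instℒ, hftL, hregL, φL, hφLet, hφLg, vL, 𝔔L, h𝔔Lp, h𝔔LvL, hunitsL, hφLv⟩ :=
    RootAdjoinRechart.exists_rootAdjoin_chart k X g A' S 𝒮' φ' hφ'g v' 𝔔 h𝔔v' (B.map ι) (fun x => (hunits' x).symm) u (ι b)
      hu' huQ a (ℓ ^ (f' + 1)) hd1 hda hreg
  letI := iL
  letI := aL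
  letI := instℒ
  haveI := hftL
  haveI := hregL
  haveI := hφLet
  haveI := h𝔔Lp
  -- (8) the unit-degree subgroup of `𝔔L` and the complement `C × ℤ/d`
  have hÃ : AddMonoid.IsTorsion (A' × ZMod (ℓ ^ (f' + 1))) := fun x => isOfFinAddOrder_of_finite x
  obtain ⟨Bt, hBt, -⟩ := StabilizerSubgroup.exists_unitDegrees_addSubgroup ℒ hÃ 𝔔L
  have hBt' : ∀ p : A' × ZMod (ℓ ^ (f' + 1)), p ∈ Bt ↔ p.1 - p.2.val • a ∈ B.map ι := fun p =>
    (hBt p).trans (hunitsL p)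
  let Ct : AddSubgroup (A' × ZMod (ℓ ^ (f' + 1))) := C.prod ⊤
  have ha1 : ((a, (1 : ZMod (ℓ ^ (f' + 1)))) : A' × ZMod (ℓ ^ (f' + 1))) ∈ Bt := by
    rw [hBt', ZMod.val_one, one_smul, sub_self]
    exact zero_mem _
  have hsupt : Bt ⊔ Ct = ⊤ := by
    rw [eq_top_iff]
    rintro ⟨x, m⟩ -
    have hx : x ∈ AddSubgroup.zmultiples a ⊔ C := by rw [hsupC]; exact AddSubgroup.mem_top x
    obtain ⟨y, hy, c, hc, rfl⟩ := AddSubgroup.mem_sup.1 hx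
    obtain ⟨j, rfl⟩ := AddSubgroup.mem_zmultiples_iff.1 hy
    have heq : ((j • a + c, m) : A' × ZMod (ℓ ^ (f' + 1))) =
        j • (a, (1 : ZMod (ℓ ^ (f' + 1)))) + (c, m - j • (1 : ZMod (ℓ ^ (f' + 1)))) := by
      ext <;> simp
    rw [heq]
    exact add_mem (AddSubgroup.mem_sup_left (zsmul_mem ha1 j))
      (AddSubgroup.mem_sup_right (AddSubgroup.mem_prod.2 ⟨hc, AddSubgroup.mem_top _⟩))
  -- (9) split off
  obtain ⟨K, dK, hKC, S'', iS'', aS'', 𝒮'', inst𝒮'', hft'', hreg'', φ'', hφ''et, hφ''g, v'', 𝔔'', h𝔔''p, h𝔔''v'', hunits'',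
    hφ''v⟩ := SubchartOfSummand.exists_subchart_of_sup_eq_top k X g (A' × ZMod (ℓ ^ (f' + 1))) L ℒ φL hφLg vL 𝔔L h𝔔LvL
      Bt Ct hBt hsupt
  letI := dK
  letI := iS''
  letI := aS''
  letI := inst𝒮''
  haveI := h𝔔''p
  have hK' : AddMonoid.IsTorsion K := fun x => isOfFinAddOrder_of_finite x
  obtain ⟨B'', hB'', -⟩ := StabilizerSubgroup.exists_unitDegrees_addSubgroup 𝒮'' hK' 𝔔''
  have hB''t : ∀ c : K, c ∈ B'' ↔ (c : A' × ZMod (ℓ ^ (f' + 1))) ∈ Bt := fun c => (hB'' c).trans (hunits'' c)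
  -- (10) the comparison map `B → B''`, `β ↦ (c_β, −s β)`
  have hcf' : ∀ i : A, cf i = ι i - (s i).val • a := fun i => by rw [hcf i, add_sub_cancel_right]
  let xm : A → ZMod (ℓ ^ (f' + 1)) := fun i => -(((s i).val : ℕ) : ZMod (ℓ ^ (f' + 1)))
  have hsum : ∀ i : A, (ℓ ^ (f' + 1)) ∣ ((s i).val + (xm i).val) := by
    intro i
    rw [← ZMod.natCast_eq_zero_iff, Nat.cast_add, ZMod.natCast_zmod_val]
    exact add_neg_cancel _
  have hxBt : ∀ i ∈ B, ((cf i, xm i) : A' × ZMod (ℓ ^ (f' + 1))) ∈ Bt := by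
    intro i hi
    rw [hBt']
    obtain ⟨t, ht⟩ := hsum i
    have h1 : cf i - (xm i).val • a = ι (i - t • b) := by
      rw [hcf', sub_sub, ← add_smul, ht, mul_comm, mul_smul, hda, ← map_nsmul, ← map_sub]
    rw [h1]
    exact AddSubgroup.mem_map.2 ⟨_, B.sub_mem hi (B.nsmul_mem hbB t), rfl⟩
  have hxK : ∀ i : A, ((cf i, xm i) : A' × ZMod (ℓ ^ (f' + 1))) ∈ K := fun i => by
    rw [hKC]; exact AddSubgroup.mem_prod.2 ⟨hcfC i, AddSubgroup.mem_top _⟩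
  let fB : B → B'' := fun β => ⟨⟨(cf β, xm β), hxK β⟩, (hB''t _).2 (hxBt β β.2)⟩
  have hfval : ∀ β : B, (((fB β : B'') : K) : A' × ZMod (ℓ ^ (f' + 1))) = (cf β, xm β) := fun β => rfl
  -- surjective
  have hsurj : Function.Surjective fB := by
    intro y
    have hyK : ((y : K) : A' × ZMod (ℓ ^ (f' + 1))) ∈ Ct := by rw [← hKC]; exact (y : K).2
    have hyBt : ((y : K) : A' × ZMod (ℓ ^ (f' + 1))) ∈ Bt := (hB''t _).1 y.2
    set c := ((y : K) : A' × ZMod (ℓ ^ (f' + 1))).1 with hcdef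
    set m := ((y : K) : A' × ZMod (ℓ ^ (f' + 1))).2 with hmdef
    have hcC : c ∈ C := (AddSubgroup.mem_prod.1 hyK).1
    obtain ⟨β, hβ, hβeq⟩ := AddSubgroup.mem_map.1 ((hBt' _).1 hyBt)
    -- `ι β = c − m.val • a`
    have hdiff : cf β - c = -(((s β).val + m.val) • a) := by
      rw [hcf', hβeq, add_smul]; abel
    have hcfβ : cf β = c := by
      have hmemC : cf β - c ∈ C := C.sub_mem (hcfC β) hcC
      have hmema : cf β - c ∈ AddSubgroup.zmultiples a := by
        rw [hdiff]; exact neg_mem (AddSubgroup.nsmul_mem _ (AddSubgroup.mem_zmultiples a) _)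
      have h0 : cf β - c ∈ AddSubgroup.zmultiples a ⊓ C := ⟨hmema, hmemC⟩
      rw [hinfC, AddSubgroup.mem_bot, sub_eq_zero] at h0
      exact h0
    have hm : xm β = m := by
      have h0 : ((s β).val + m.val) • a = 0 := by
        have := hdiff; rw [hcfβ, sub_self, eq_comm, neg_eq_zero] at this; exact this
      have hdvd : ℓ ^ (f' + 1) ∣ (s β).val + m.val := (Dvd.intro_left _ rfl).trans (hord _ h0)
      have hz : (((s β).val : ℕ) : ZMod (ℓ ^ (f' + 1))) + m = 0 := by
        rw [← ZMod.natCast_zmod_val m, ← Nat.cast_add, ZMod.natCast_eq_zero_iff]; exact hdvd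
      exact (neg_eq_of_add_eq_zero_right hz)
    refine ⟨⟨β, hβ⟩, Subtype.ext (Subtype.ext (Prod.ext hcfβ hm))⟩
  -- not injective: `b ↦ 0 ← 0`
  have hsb : (s b).val = ℓ ^ (f' + 1) := by
    rw [hs, ZMod.val_natCast_of_lt]
    calc ℓ ^ (f' + 1) = 1 * ℓ ^ (f' + 1) := (one_mul _).symm
      _ < addOrderOf b * ℓ ^ (f' + 1) := by
        refine Nat.mul_lt_mul_of_pos_right ?_ (by omega)
        rw [hbord]; exact Nat.one_lt_pow (Nat.succ_ne_zero e) hℓ.one_lt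
  have hfb : fB ⟨b, hbB⟩ = fB ⟨0, B.zero_mem⟩ := by
    apply Subtype.ext; apply Subtype.ext
    rw [hfval, hfval]
    ext
    · simp only [hcf', hsb, hda, sub_self, map_zero, ZMod.val_zero, zero_smul]
    · simp only [xm, hsb, map_zero, ZMod.val_zero, Nat.cast_zero, neg_zero, ZMod.natCast_self]
  have hninj : ¬ Function.Injective fB := fun hinj => hb0 (by simpa using congrArg Subtype.val (hinj hfb))
  have hlt : Nat.card B'' < Nat.card B := by
    refine lt_of_le_of_ne (Nat.card_le_card_of_surjective fB hsurj) fun h => hninj ?_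
    exact ((Nat.bijective_iff_surjective_and_card fB).2 ⟨hsurj, h.symm⟩).1
  -- assemble
  refine ⟨K, inferInstance, inferInstance, dK, S'', iS'', aS'', 𝒮'', inst𝒮'', hft'', hreg'', φ'', hφ''et, hφ''g, v'', 𝔔'', h𝔔''p,
    h𝔔''v'', B'', hB'', hlt, ?_⟩
  rw [hφ''v, hφLv, hφ'v]

end Summit.ResolutionOfSingularities.ResolutionOfSingularities.Theorems.FRationalResolution.RechartStep

end
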